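import Literature.Probability.LatticeModels.GinibreCharacterExpansion
import Mathlib.Analysis.Normed.Ring.InfiniteSum
import Mathlib.Data.Nat.Choose.Vandermonde
import Mathlib.Analysis.SpecialFunctions.Trigonometric.DerivHyp
import Mathlib.Analysis.SpecialFunctions.Log.Basic
import HarnessLib

/-!
# Modified Bessel coefficients `I_n(x)`: recurrence, product formula, and Amos' two-sided ratio
and Gaussian bounds

Sibling of `GinibreBesselBounds.lean` (Turán's inequality for `x ≥ 0` by total positivity,
monotonicity in the order, `0 < I_n/I_0 ≤ 1`, the factorial bound `I_m ≤ (x/2)^m/m! · I_0`).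
The dual plaquette weights of four-dimensional `U(1)` lattice gauge theory with Wilson's action
are `λ(n) = I_n(β)/I_0(β)` (`U1DualRepresentation`, `U1DualFluxEnsemble`); for the Villain action
they are exactly Gaussian, `e^{-n²/2β}`, and every weak-coupling analysis of the Wilson-action
theory (Fröhlich–Spencer 1982, p. 433, referring to the Bessel-function estimates of
Fröhlich–Spencer 1981, Appendix B, pp. 597–599, used in its Sect. 6, p. 576, conditions (a)–(d))
needs the *Gaussian behaviour* `λ(n) ≈ e^{-n²/2β}` in the regime `|n| ≲ β`, where the factorial
bound is void. This file proves it at integer orders, for the tree's power-series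
`besselI : ℤ → ℝ → ℝ`, from the three-term recurrence and Turán's inequality exactly as in
Amos (1974), p. 241; everything is a theorem (no definitions, no named facts):

* `besselI_recurrence` — `x I_m(x) - x I_{m+2}(x) = 2(m+1) I_{m+1}(x)` (all real `x`; termwise);
* `besselI_mul_besselI` — the **product formula**
  `I_m(x) I_n(x) = ∑_k (x/2)^{2k+m+n} C(2k+m+n, k) / ((k+m)! (k+n)!)` (Cauchy product of the two
  power series collected with Vandermonde's identity), with its corollary
  `besselI_mul_besselI_add_two_le_sq` — Turán's inequality `I_m I_{m+2} ≤ I_{m+1}²` for ALL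
  real `x` (termwise positivity: `(k+m+1)!² ≤ (k+m)!(k+m+2)!`);
* `mul_besselI_le_mul_besselI_succ` / `div_le_besselI_succ_div_besselI` — **Amos' lower bound
  (9)** `I_{m+1}/I_m ≥ x / (m+1+√(x²+(m+1)²))` (`x > 0`, `m ≥ 0`);
* `mul_besselI_succ_le_mul_besselI` / `besselI_succ_div_besselI_le_div` — **Amos' upper bound
  (11)** `I_{m+1}/I_m ≤ x / (m+√(x²+(m+2)²))`, and the handier `add_mul_besselI_succ_le` —
  `I_{m+1}/I_m ≤ x/(x+m)`;
* `exp_mul_besselI_zero_le_besselI`, `besselI_le_exp_mul_besselI_zero`,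
  `besselI_div_besselI_zero_mem_Icc` — the **two-sided Gaussian bounds**
  `e^{-|n|(|n|+1)/(2x)} ≤ I_n(x)/I_0(x) ≤ e^{-|n|(|n|-1)/(2(x+|n|))}` (`x > 0`, `n ∈ ℤ`): Gaussian
  with the sharp constant `1/(2x)` to leading order for `|n| ≪ x`, exponential for `|n| ≫ x`.

Proofs: with `A, B, C = I_m, I_{m+1}, I_{m+2}` the recurrence `x(A - C) = 2(m+1)B` and Turán
`AC ≤ B²` give `(xA - (m+1)B)² = x²AC + (m+1)²B² ≤ B²(x² + (m+1)²)`, which is (9); inserting (9)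
at the next order into `xA = 2(m+1)B + xC` gives (11) (Amos' "iterative improvement"); the
exponential forms follow from `u + √(1+u²) ≤ e^u` (`arsinh u ≤ u`) and `log y ≤ y - 1`, summed
over the orders.

## References

* D. E. Amos, *Computation of modified Bessel functions and their ratios*, Math. Comp. 28
  (1974) 239–251: (1) p. 239 (recurrence), (9)–(11) p. 241 (two-sided ratio bounds). [Amos1974]
* J. Segura, *Bounds for ratios of modified Bessel functions and associated Turán-type
  inequalities*, J. Math. Anal. Appl. 374 (2011) 516–528, Theorem 7 (44), p. 522 (Turán's
  inequality; §4.1 p. 521 relates it to Amos' bounds). [Segura2011]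
* J. Fröhlich, T. Spencer, Comm. Math. Phys. 81 (1981) 527–602, Sect. 6 p. 576 and Appendix B
  pp. 597–599. [FrohlichSpencerKT1981]
* J. Fröhlich, T. Spencer, Comm. Math. Phys. 83 (1982) 411–454, p. 433. [FrohlichSpencerCMP1982]
-/

noncomputable section

open Filter Finset
open scoped BigOperators Nat Topology

namespace Literature.Probability.LatticeModels

/-! ### `ℕ`-indexed form of the series -/

/-- The Bessel term at a natural order: `(x/2)^{2k+m} / (k! (k+m)!)`. [folklore] -/
theorem besselITerm_natCast (m : ℕ) (x : ℝ) (k : ℕ) :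
    besselITerm (m : ℤ) x k = (x / 2) ^ (2 * k + m) / ((k ! : ℝ) * ((k + m)! : ℝ)) := by
  simp [besselITerm]

/-- `I_m(x) = ∑_k (x/2)^{2k+m} / (k! (k+m)!)` for `m : ℕ`. [folklore] -/
theorem besselI_natCast_eq_tsum (m : ℕ) (x : ℝ) :
    besselI (m : ℤ) x = ∑' k : ℕ, (x / 2) ^ (2 * k + m) / ((k ! : ℝ) * ((k + m)! : ℝ)) := by
  simp [besselI, besselITerm_natCast]

/-! ### The three-term recurrence `x (I_m - I_{m+2}) = 2(m+1) I_{m+1}` -/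

/-- Termwise identity behind the recurrence (the `k = 0` term of `I_m` is handled separately):
`x·t_m(k+1) - x·t_{m+2}(k) = 2(m+1)·t_{m+1}(k+1)`. [folklore] -/
theorem besselITerm_recurrence_succ (m : ℕ) (x : ℝ) (k : ℕ) :
    x * besselITerm (m : ℤ) x (k + 1) - x * besselITerm ((m + 2 : ℕ) : ℤ) x k =
      2 * (m + 1) * besselITerm ((m + 1 : ℕ) : ℤ) x (k + 1) := by
  simp only [besselITerm_natCast]
  have e1 : 2 * (k + 1) + m = 2 * k + m + 2 := by ring
  have e2 : 2 * k + (m + 2) = 2 * k + m + 2 := by ring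
  have e3 : 2 * (k + 1) + (m + 1) = 2 * k + m + 2 + 1 := by ring
  have f1 : k + 1 + m = (k + m) + 1 := by ring
  have f2 : k + (m + 2) = (k + m + 1) + 1 := by ring
  have f3 : k + 1 + (m + 1) = (k + m + 1) + 1 := by ring
  rw [e1, e2, e3, f1, f2, f3]
  simp only [Nat.factorial_succ, Nat.cast_mul, Nat.cast_add, Nat.cast_one, pow_succ]
  have hk : (0 : ℝ) < k ! := by exact_mod_cast Nat.factorial_pos k
  have hkm : (0 : ℝ) < (k + m)! := by exact_mod_cast Nat.factorial_pos (k + m)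
  field_simp
  ring

/-- The `k = 0` terms: `x·t_m(0) = 2(m+1)·t_{m+1}(0)`. [folklore] -/
theorem besselITerm_recurrence_zero (m : ℕ) (x : ℝ) :
    x * besselITerm (m : ℤ) x 0 = 2 * (m + 1) * besselITerm ((m + 1 : ℕ) : ℤ) x 0 := by
  simp only [besselITerm_natCast, mul_zero, zero_add, Nat.factorial_zero, Nat.cast_one, one_mul]
  rw [Nat.factorial_succ, Nat.cast_mul, pow_succ]
  have hm : (0 : ℝ) < m ! := by exact_mod_cast Nat.factorial_pos m
  field_simp
  push_cast
  ring

/-- **Three-term recurrence of the modified Bessel functions** (integer order `m ≥ 0`, any real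
argument): `x·I_m(x) - x·I_{m+2}(x) = 2(m+1)·I_{m+1}(x)`, i.e.
`I_{ν-1}(x) - I_{ν+1}(x) = (2ν/x) I_ν(x)` with `ν = m + 1`.
[cite: Amos1974, (1) p. 239] -/
theorem besselI_recurrence (m : ℕ) (x : ℝ) :
    x * besselI (m : ℤ) x - x * besselI ((m + 2 : ℕ) : ℤ) x =
      2 * (m + 1) * besselI ((m + 1 : ℕ) : ℤ) x := by
  have hs := fun j : ℕ => summable_besselITerm (j : ℤ) x
  have hs1 : Summable fun k => besselITerm (m : ℤ) x (k + 1) :=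
    (summable_nat_add_iff 1).mpr (hs m)
  rw [besselI, besselI, besselI, (hs m).tsum_eq_zero_add, (hs (m + 1)).tsum_eq_zero_add]
  have htail : x * ∑' k, besselITerm (m : ℤ) x (k + 1) -
      x * ∑' k, besselITerm ((m + 2 : ℕ) : ℤ) x k =
        2 * (m + 1) * ∑' k, besselITerm ((m + 1 : ℕ) : ℤ) x (k + 1) := by
    rw [← tsum_mul_left, ← tsum_mul_left, ← (hs1.mul_left x).tsum_sub ((hs (m + 2)).mul_left x),
      ← tsum_mul_left]
    exact tsum_congr (besselITerm_recurrence_succ m x)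
  have h0 := besselITerm_recurrence_zero m x
  linear_combination h0 + htail

/-! ### The product formula and the Turán inequality -/

/-- Norm-summability of the Bessel terms (for the Cauchy product). [folklore] -/
theorem summable_norm_besselITerm (m : ℤ) (x : ℝ) : Summable fun k => ‖besselITerm m x k‖ :=
  (summable_besselITerm m x).norm

/-- One term of the Cauchy product:
`t_m(a) t_n(b) = (x/2)^{2(a+b)+m+n} · C(a+b+n, a) C(a+b+m, b) / ((a+b+m)! (a+b+n)!)`.
[folklore] -/
theorem besselITerm_mul_besselITerm (m n a b : ℕ) (x : ℝ) :
    besselITerm (m : ℤ) x a * besselITerm (n : ℤ) x b =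
      (x / 2) ^ (2 * (a + b) + m + n) *
        ((((a + b + n).choose a * (a + b + m).choose b : ℕ)) : ℝ) /
        (((a + b + m)! : ℝ) * ((a + b + n)! : ℝ)) := by
  simp only [besselITerm_natCast]
  have h1 : (((a + b + n).choose a : ℕ) : ℝ) * a ! * (b + n)! = (a + b + n)! := by
    have h := Nat.add_choose_mul_factorial_mul_factorial (b + n) a
    rw [show b + n + a = a + b + n by ring] at h
    exact_mod_cast (show (a + b + n).choose a * a ! * (b + n)! = (a + b + n)! by
      rw [mul_assoc, mul_comm (a !), ← mul_assoc]; exact h)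
  have h2 : (((a + b + m).choose b : ℕ) : ℝ) * b ! * (a + m)! = (a + b + m)! := by
    have h := Nat.add_choose_mul_factorial_mul_factorial (a + m) b
    rw [show a + m + b = a + b + m by ring] at h
    exact_mod_cast (show (a + b + m).choose b * b ! * (a + m)! = (a + b + m)! by
      rw [mul_assoc, mul_comm (b !), ← mul_assoc]; exact h)
  rw [div_mul_div_comm, ← pow_add, show 2 * a + m + (2 * b + n) = 2 * (a + b) + m + n by ring,
    div_eq_div_iff (by positivity) (by positivity)]
  push_cast
  rw [← h1, ← h2]
  ring

/-- The `k`-th coefficient of the Cauchy product (Vandermonde's convolution):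
`∑_{a+b=k} t_m(a) t_n(b) = (x/2)^{2k+m+n} C(2k+m+n, k) / ((k+m)! (k+n)!)`. [folklore] -/
theorem sum_antidiagonal_besselITerm_mul (m n k : ℕ) (x : ℝ) :
    ∑ ab ∈ antidiagonal k, besselITerm (m : ℤ) x ab.1 * besselITerm (n : ℤ) x ab.2 =
      (x / 2) ^ (2 * k + m + n) * (((2 * k + m + n).choose k : ℕ) : ℝ) /
        (((k + m)! : ℝ) * ((k + n)! : ℝ)) := by
  have hV := Nat.add_choose_eq (k + n) (k + m) k
  rw [show k + n + (k + m) = 2 * k + m + n by ring] at hV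
  rw [hV, Nat.cast_sum, Finset.mul_sum, Finset.sum_div]
  refine Finset.sum_congr rfl fun ab hab => ?_
  rw [Finset.mem_antidiagonal] at hab
  rw [besselITerm_mul_besselITerm, hab]

/-- The explicit coefficient series of `I_m(x) I_n(x)` is summable. [folklore] -/
theorem summable_besselIProdTerm (m n : ℕ) (x : ℝ) :
    Summable fun k : ℕ => (x / 2) ^ (2 * k + m + n) * (((2 * k + m + n).choose k : ℕ) : ℝ) /
        (((k + m)! : ℝ) * ((k + n)! : ℝ)) := by
  have h := (summable_norm_sum_mul_antidiagonal_of_summable_norm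
    (summable_norm_besselITerm (m : ℤ) x) (summable_norm_besselITerm (n : ℤ) x)).of_norm
  exact h.congr fun k => sum_antidiagonal_besselITerm_mul m n k x

/-- **Product formula** (Cauchy product of the two power series, collected with Vandermonde's
identity): `I_m(x) I_n(x) = ∑_k (x/2)^{2k+m+n} C(2k+m+n, k) / ((k+m)! (k+n)!)`. [folklore] -/
theorem besselI_mul_besselI (m n : ℕ) (x : ℝ) :
    besselI (m : ℤ) x * besselI (n : ℤ) x =
      ∑' k : ℕ, (x / 2) ^ (2 * k + m + n) * (((2 * k + m + n).choose k : ℕ) : ℝ) /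
        (((k + m)! : ℝ) * ((k + n)! : ℝ)) := by
  rw [besselI, besselI, tsum_mul_tsum_eq_tsum_sum_antidiagonal_of_summable_norm
    (summable_norm_besselITerm _ x) (summable_norm_besselITerm _ x)]
  exact tsum_congr fun k => sum_antidiagonal_besselITerm_mul m n k x

/-- **Turán's inequality for modified Bessel functions** (Thiruvenkatachar–Nanjundiah 1951):
`I_m(x) I_{m+2}(x) ≤ I_{m+1}(x)²` for every `m ≥ 0` and EVERY real `x` — termwise from the
product formula, since `(k+m+1)!² ≤ (k+m)! (k+m+2)!` (for `x ≥ 0` this is also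
`GinibreBesselBounds.besselI_pred_mul_succ_le_sq`, proved there by total positivity; the present
corollary of the product formula needs no sign condition). [cite: Segura2011, Theorem 7 (44) p. 522] -/
theorem besselI_mul_besselI_add_two_le_sq (m : ℕ) (x : ℝ) :
    besselI (m : ℤ) x * besselI ((m + 2 : ℕ) : ℤ) x ≤ besselI ((m + 1 : ℕ) : ℤ) x ^ 2 := by
  rw [sq, besselI_mul_besselI, besselI_mul_besselI]
  refine (summable_besselIProdTerm m (m + 2) x).tsum_le_tsum (fun k => ?_)
    (summable_besselIProdTerm (m + 1) (m + 1) x)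
  have e1 : 2 * k + m + (m + 2) = 2 * (k + m + 1) := by ring
  have e2 : 2 * k + (m + 1) + (m + 1) = 2 * (k + m + 1) := by ring
  rw [e1, e2, pow_mul]
  refine div_le_div_of_nonneg_left (by positivity) (by positivity) ?_
  have f1 : k + (m + 1) = (k + m) + 1 := by ring
  have f2 : k + (m + 2) = (k + m) + 1 + 1 := by ring
  rw [f1, f2]
  simp only [Nat.factorial_succ, Nat.cast_mul, Nat.cast_add, Nat.cast_one]
  have h0 : (0 : ℝ) ≤ (k + m)! := by positivity
  have h1 : (0 : ℝ) ≤ ((k : ℝ) + m + 1) * (k + m)! * (k + m)! := by positivity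
  nlinarith [h1]

/-! ### Two-sided bounds on the ratios `I_{m+1}/I_m` (Amos-type) -/

/-- **Lower ratio bound** (Amos 1974): for `x > 0` and `m ≥ 0`,
`x · I_m(x) ≤ (m + 1 + √(x² + (m+1)²)) · I_{m+1}(x)`, i.e.
`I_{m+1}/I_m ≥ x / (m + 1 + √(x² + (m+1)²))`. Proof: with `A, B, C = I_m, I_{m+1}, I_{m+2}`,
the recurrence `x(A - C) = 2(m+1)B` and Turán `AC ≤ B²` give
`(xA - (m+1)B)² = x²AC + (m+1)²B² ≤ B²(x² + (m+1)²)`. [cite: Amos1974, (9) p. 241] -/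
theorem mul_besselI_le_mul_besselI_succ {x : ℝ} (hx : 0 < x) (m : ℕ) :
    x * besselI (m : ℤ) x ≤
      ((m + 1 : ℝ) + Real.sqrt (x ^ 2 + (m + 1) ^ 2)) * besselI ((m + 1 : ℕ) : ℤ) x := by
  set A := besselI (m : ℤ) x
  set B := besselI ((m + 1 : ℕ) : ℤ) x
  set C := besselI ((m + 2 : ℕ) : ℤ) x
  set s := Real.sqrt (x ^ 2 + (m + 1) ^ 2)
  have hrec : x * A - x * C = 2 * (m + 1) * B := besselI_recurrence m x
  have hT : A * C ≤ B ^ 2 := besselI_mul_besselI_add_two_le_sq m x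
  have hB : 0 < B := besselI_pos hx _
  have hs : 0 ≤ s := Real.sqrt_nonneg _
  have hs2 : s ^ 2 = x ^ 2 + (m + 1) ^ 2 := Real.sq_sqrt (by positivity)
  have key : (x * A - (m + 1) * B) ^ 2 ≤ (B * s) ^ 2 := by
    have : (x * A - (m + 1) * B) ^ 2 = x ^ 2 * (A * C) + (m + 1) ^ 2 * B ^ 2 := by
      linear_combination (x * A) * hrec
    rw [this, mul_pow, hs2]
    nlinarith [hT, sq_nonneg x]
  have habs : |x * A - (m + 1) * B| ≤ |B * s| := sq_le_sq.mp key
  rw [abs_of_nonneg (mul_nonneg hB.le hs)] at habs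
  have := (le_abs_self _).trans habs
  nlinarith [this]

/-- The lower ratio bound in quotient form:
`x / (m + 1 + √(x² + (m+1)²)) ≤ I_{m+1}(x)/I_m(x)`. [cite: Amos1974, (9) p. 241] -/
theorem div_le_besselI_succ_div_besselI {x : ℝ} (hx : 0 < x) (m : ℕ) :
    x / ((m + 1 : ℝ) + Real.sqrt (x ^ 2 + (m + 1) ^ 2)) ≤
      besselI ((m + 1 : ℕ) : ℤ) x / besselI (m : ℤ) x := by
  have hA : 0 < besselI (m : ℤ) x := besselI_pos hx _
  have hD : 0 < (m + 1 : ℝ) + Real.sqrt (x ^ 2 + (m + 1) ^ 2) := by positivity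
  rw [div_le_div_iff₀ hD hA]
  simpa [mul_comm] using mul_besselI_le_mul_besselI_succ hx m

/-- **Upper ratio bound** (Amos-type): for `x > 0` and `m ≥ 0`,
`(m + √(x² + (m+2)²)) · I_{m+1}(x) ≤ x · I_m(x)`, i.e.
`I_{m+1}/I_m ≤ x / (m + √(x² + (m+2)²))` — from the recurrence `xA = 2(m+1)B + xC` and the
lower bound `xB ≤ (m + 2 + √(x² + (m+2)²)) C` at the next order (Amos' iterative improvement).
[cite: Amos1974, (11) p. 241] -/
theorem mul_besselI_succ_le_mul_besselI {x : ℝ} (hx : 0 < x) (m : ℕ) :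
    ((m : ℝ) + Real.sqrt (x ^ 2 + (m + 2) ^ 2)) * besselI ((m + 1 : ℕ) : ℤ) x ≤
      x * besselI (m : ℤ) x := by
  set A := besselI (m : ℤ) x
  set B := besselI ((m + 1 : ℕ) : ℤ) x
  set C := besselI ((m + 2 : ℕ) : ℤ) x
  set s := Real.sqrt (x ^ 2 + (m + 2) ^ 2)
  have hrec : x * A - x * C = 2 * (m + 1) * B := besselI_recurrence m x
  have hlow : x * B ≤ ((m + 2 : ℝ) + s) * C := by
    have h := mul_besselI_le_mul_besselI_succ hx (m + 1)
    have e1 : ((m + 1 : ℕ) : ℝ) + 1 = (m : ℝ) + 2 := by push_cast; ring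
    rw [e1, show m + 1 + 1 = m + 2 from rfl] at h
    exact h
  have hB : 0 < B := besselI_pos hx _
  have hC : 0 < C := besselI_pos hx _
  have hs : 0 ≤ s := Real.sqrt_nonneg _
  have hs2 : s ^ 2 = x ^ 2 + (m + 2) ^ 2 := Real.sq_sqrt (by positivity)
  -- `B (s - (m+2)) (s + (m+2)) = B x² ≤ x C (s + (m+2))`, hence `B (s - (m+2)) ≤ x C`.
  have h1 : B * (s - (m + 2)) * ((m + 2) + s) ≤ x * C * ((m + 2) + s) := by
    have : B * (s - (m + 2)) * ((m + 2) + s) = x * (x * B) := by nlinarith [hs2]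
    rw [this]
    nlinarith [hlow, hx]
  have h2 : B * (s - (m + 2)) ≤ x * C := le_of_mul_le_mul_right h1 (by positivity)
  nlinarith [h2, hrec]

/-- The upper ratio bound in quotient form: `I_{m+1}(x)/I_m(x) ≤ x / (m + √(x² + (m+2)²))`.
[cite: Amos1974, (11) p. 241] -/
theorem besselI_succ_div_besselI_le_div {x : ℝ} (hx : 0 < x) (m : ℕ) :
    besselI ((m + 1 : ℕ) : ℤ) x / besselI (m : ℤ) x ≤
      x / ((m : ℝ) + Real.sqrt (x ^ 2 + (m + 2) ^ 2)) := by
  have hA : 0 < besselI (m : ℤ) x := besselI_pos hx _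
  have hD : 0 < (m : ℝ) + Real.sqrt (x ^ 2 + (m + 2) ^ 2) := by positivity
  rw [div_le_div_iff₀ hA hD]
  simpa [mul_comm] using mul_besselI_succ_le_mul_besselI hx m

/-- A weaker but handier upper ratio bound: `(x + m) I_{m+1}(x) ≤ x I_m(x)`, i.e.
`I_{m+1}/I_m ≤ x/(x+m)`. [cite: Amos1974, (11) p. 241] -/
theorem add_mul_besselI_succ_le {x : ℝ} (hx : 0 < x) (m : ℕ) :
    (x + m) * besselI ((m + 1 : ℕ) : ℤ) x ≤ x * besselI (m : ℤ) x := by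
  have h := mul_besselI_succ_le_mul_besselI hx m
  have hB : 0 ≤ besselI ((m + 1 : ℕ) : ℤ) x := besselI_nonneg hx.le _
  have hs : x ≤ Real.sqrt (x ^ 2 + (m + 2) ^ 2) := by
    calc x = Real.sqrt (x ^ 2) := (Real.sqrt_sq hx.le).symm
      _ ≤ Real.sqrt (x ^ 2 + (m + 2) ^ 2) :=
        Real.sqrt_le_sqrt (le_add_of_nonneg_right (by positivity))
  nlinarith [mul_le_mul_of_nonneg_right hs hB]

/-! ### Gaussian-type two-sided bounds on `I_n(x)/I_0(x)` -/

/-- `u + √(1 + u²) ≤ e^u` for `u ≥ 0` (equivalently `arsinh u ≤ u`, from `u ≤ sinh u`).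
[folklore] -/
theorem add_sqrt_one_add_sq_le_exp {u : ℝ} (hu : 0 ≤ u) :
    u + Real.sqrt (1 + u ^ 2) ≤ Real.exp u := by
  have hsinh : u ≤ Real.sinh u := Real.self_le_sinh_iff.mpr hu
  rw [Real.sinh_eq] at hsinh
  have hpos : 0 < Real.exp u := Real.exp_pos u
  have hinv : Real.exp (-u) = (Real.exp u)⁻¹ := Real.exp_neg u
  have h1 : 0 ≤ Real.exp u - u := by linarith [Real.add_one_le_exp u]
  have key : 1 + u ^ 2 ≤ (Real.exp u - u) ^ 2 := by
    have hmul : Real.exp u * Real.exp (-u) = 1 := by rw [hinv, mul_inv_cancel₀ hpos.ne']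
    nlinarith [hmul, hsinh, Real.exp_pos (-u)]
  have := Real.sqrt_le_sqrt key
  rw [Real.sqrt_sq h1] at this
  linarith

/-- One step of the Gaussian lower bound: `e^{-(m+1)/x} I_m(x) ≤ I_{m+1}(x)` (`x > 0`;
Amos' (9) and `arsinh u ≤ u`). [cite: Amos1974, (9) p. 241] -/
theorem exp_mul_besselI_le_besselI_succ {x : ℝ} (hx : 0 < x) (m : ℕ) :
    Real.exp (-((m + 1) / x)) * besselI (m : ℤ) x ≤ besselI ((m + 1 : ℕ) : ℤ) x := by
  have h := mul_besselI_le_mul_besselI_succ hx m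
  set u : ℝ := (m + 1) / x with hu_def
  have hu : 0 ≤ u := by positivity
  have hux : (m + 1 : ℝ) = u * x := by rw [hu_def]; field_simp
  have hsq : Real.sqrt (x ^ 2 + (m + 1) ^ 2) = x * Real.sqrt (1 + u ^ 2) := by
    rw [hux, show x ^ 2 + (u * x) ^ 2 = x ^ 2 * (1 + u ^ 2) by ring, Real.sqrt_mul (sq_nonneg x),
      Real.sqrt_sq hx.le]
  rw [hsq, hux] at h
  -- h : x * I_m ≤ (u x + x √(1+u²)) I_{m+1} = x (u + √(1+u²)) I_{m+1}
  have hB : 0 ≤ besselI ((m + 1 : ℕ) : ℤ) x := besselI_nonneg hx.le _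
  have hA : 0 ≤ besselI (m : ℤ) x := besselI_nonneg hx.le _
  have h' : besselI (m : ℤ) x ≤ (u + Real.sqrt (1 + u ^ 2)) * besselI ((m + 1 : ℕ) : ℤ) x := by
    have := h
    have hx' : 0 < x := hx
    nlinarith [this]
  have hE := add_sqrt_one_add_sq_le_exp hu
  have hEpos : 0 < Real.exp u := Real.exp_pos u
  calc Real.exp (-u) * besselI (m : ℤ) x
      ≤ Real.exp (-u) * ((u + Real.sqrt (1 + u ^ 2)) * besselI ((m + 1 : ℕ) : ℤ) x) :=
        mul_le_mul_of_nonneg_left h' (Real.exp_pos _).le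
    _ ≤ Real.exp (-u) * (Real.exp u * besselI ((m + 1 : ℕ) : ℤ) x) := by
        gcongr
    _ = besselI ((m + 1 : ℕ) : ℤ) x := by
        rw [← mul_assoc, ← Real.exp_add, neg_add_cancel, Real.exp_zero, one_mul]

/-- **Gaussian lower bound**: `I_n(x) ≥ e^{-n(n+1)/(2x)} I_0(x)` for `x > 0`, `n ≥ 0`
(product of the one-step bounds). [cite: Amos1974, (9) p. 241] -/
theorem exp_mul_besselI_zero_le_besselI {x : ℝ} (hx : 0 < x) (n : ℕ) :
    Real.exp (-(n * (n + 1) / (2 * x))) * besselI 0 x ≤ besselI (n : ℤ) x := by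
  induction n with
  | zero => simp
  | succ n ih =>
    have hstep := exp_mul_besselI_le_besselI_succ hx n
    have hsplit : Real.exp (-((n + 1 : ℕ) * ((n + 1 : ℕ) + 1) / (2 * x))) =
        Real.exp (-((n + 1) / x)) * Real.exp (-(n * (n + 1) / (2 * x))) := by
      rw [← Real.exp_add]
      congr 1
      push_cast
      field_simp
      ring
    rw [hsplit, mul_assoc]
    exact (mul_le_mul_of_nonneg_left ih (Real.exp_pos _).le).trans hstep

/-- One step of the Gaussian upper bound: `I_{m+1}(x) ≤ e^{-m/(x+m)} I_m(x)` (`x > 0`;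
Amos' (11) and `log y ≤ y - 1`). [cite: Amos1974, (11) p. 241] -/
theorem besselI_succ_le_exp_mul_besselI {x : ℝ} (hx : 0 < x) (m : ℕ) :
    besselI ((m + 1 : ℕ) : ℤ) x ≤ Real.exp (-(m / (x + m))) * besselI (m : ℤ) x := by
  have h := add_mul_besselI_succ_le hx m
  have hA : 0 ≤ besselI (m : ℤ) x := besselI_nonneg hx.le _
  have hxm : 0 < x + m := by positivity
  -- `x/(x+m) ≤ exp(x/(x+m) - 1) = exp(-m/(x+m))` by `log y ≤ y - 1`.
  have hq : x / (x + m) ≤ Real.exp (-(m / (x + m))) := by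
    have hq0 : 0 < x / (x + m) := by positivity
    have := Real.log_le_sub_one_of_pos hq0
    have h2 : x / (x + m) - 1 = -(m / (x + m)) := by field_simp; ring
    rw [h2] at this
    calc x / (x + m) = Real.exp (Real.log (x / (x + m))) := (Real.exp_log hq0).symm
      _ ≤ Real.exp (-(m / (x + m))) := Real.exp_le_exp.mpr this
  calc besselI ((m + 1 : ℕ) : ℤ) x ≤ x / (x + m) * besselI (m : ℤ) x := by
        rw [div_mul_eq_mul_div, le_div_iff₀ hxm]
        simpa [mul_comm] using h
    _ ≤ Real.exp (-(m / (x + m))) * besselI (m : ℤ) x := mul_le_mul_of_nonneg_right hq hA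

/-- **Gaussian upper bound**: `I_n(x) ≤ e^{-n(n-1)/(2(x+n))} I_0(x)` for `x > 0`, `n ≥ 0`
(the exponent has the sharp constant `1/(2x)` to leading order as `x → ∞`, and the bound is
exponential in `n` for `n ≫ x`; product of the one-step bounds). [cite: Amos1974, (11) p. 241] -/
theorem besselI_le_exp_mul_besselI_zero {x : ℝ} (hx : 0 < x) (n : ℕ) :
    besselI (n : ℤ) x ≤ Real.exp (-(n * (n - 1) / (2 * (x + n)))) * besselI 0 x := by
  -- first the bound with the sum `∑_{m<n} m/(x+m)` in the exponent, by induction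
  have hsum : ∀ n : ℕ, besselI (n : ℤ) x ≤
      Real.exp (-(∑ m ∈ Finset.range n, (m : ℝ) / (x + m))) * besselI 0 x := by
    intro n
    induction n with
    | zero => simp
    | succ n ih =>
      rw [Finset.sum_range_succ, neg_add, Real.exp_add, mul_comm (Real.exp _) (Real.exp _),
        mul_assoc]
      exact (besselI_succ_le_exp_mul_besselI hx n).trans
        (mul_le_mul_of_nonneg_left ih (Real.exp_pos _).le)
  refine (hsum n).trans (mul_le_mul_of_nonneg_right ?_ (besselI_nonneg hx.le 0))
  rw [Real.exp_le_exp, neg_le_neg_iff]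
  -- `n(n-1)/(2(x+n)) = ∑_{m<n} m/(x+n) ≤ ∑_{m<n} m/(x+m)`
  have hG : ∀ n : ℕ, ∑ m ∈ Finset.range n, (m : ℝ) = n * (n - 1) / 2 := by
    intro n
    induction n with
    | zero => simp
    | succ n ih => rw [Finset.sum_range_succ, ih]; push_cast; ring
  calc (n : ℝ) * (n - 1) / (2 * (x + n)) = ∑ m ∈ Finset.range n, (m : ℝ) / (x + n) := by
        rw [← Finset.sum_div, hG, div_div]
    _ ≤ ∑ m ∈ Finset.range n, (m : ℝ) / (x + m) := by
        refine Finset.sum_le_sum fun m hm => ?_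
        have hmn : (m : ℝ) ≤ n := by exact_mod_cast (Finset.mem_range.mp hm).le
        exact div_le_div_of_nonneg_left (by positivity) (by positivity) (by linarith)

/-- The two-sided Gaussian bounds for the normalised coefficients `λ(n) = I_n(x)/I_0(x)`,
`n ∈ ℤ`, `x > 0`: `e^{-|n|(|n|+1)/(2x)} ≤ I_n(x)/I_0(x) ≤ e^{-|n|(|n|-1)/(2(x+|n|))}`.
[cite: Amos1974, (9)–(11) p. 241] -/
theorem besselI_div_besselI_zero_mem_Icc {x : ℝ} (hx : 0 < x) (n : ℤ) :
    besselI n x / besselI 0 x ∈ Set.Icc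
      (Real.exp (-(n.natAbs * (n.natAbs + 1) / (2 * x))))
      (Real.exp (-(n.natAbs * (n.natAbs - 1) / (2 * (x + n.natAbs))))) := by
  have hn : besselI n x = besselI (n.natAbs : ℤ) x := by
    rcases Int.natAbs_eq n with h' | h'
    · conv_lhs => rw [h']
    · conv_lhs => rw [h', besselI_neg_index]
  have h0 : 0 < besselI 0 x := besselI_pos hx 0
  rw [hn, Set.mem_Icc, le_div_iff₀ h0, div_le_iff₀ h0]
  exact ⟨exp_mul_besselI_zero_le_besselI hx _, besselI_le_exp_mul_besselI_zero hx _⟩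

end Literature.Probability.LatticeModels
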